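import Literature.MathematicalPhysics.QuantumFieldTheory.Balaban1983to89.Node00.Sect2FrameOfRecord
import Literature.MathematicalPhysics.QuantumFieldTheory.Balaban1983to89.B14Eq227LocalizedTerms
import Literature.MathematicalPhysics.QuantumFieldTheory.Balaban1983to89.B12RegularSpaces111Mono
import Literature.MathematicalPhysics.QuantumFieldTheory.Balaban1983to89.B14RegularSpaces234Inner

/-!
# NODE 00 ∕ DEDUP №11, tranche 11c — `Sect2FormOfRecord`: THE §2 [III] FORM OF A DENSITY AS A `Prop` OF RECORD

[Balaban1988Convergent] = [III], §2 pp. 257–262 and p. 279; [Balaban1987RG1] = [I], (1.9)–(1.16) p. 262.  Sequel of `Node00.Sect2FrameOfRecord` (11b: the FRAME of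
the localized-term tower `Sect2.towerOfTerms` ∕ `sect2TowerOfRecord`, the action data `sect2ActionDataOfRecord`) and of `Node00.TkOfRecord` (11a: the operation
`𝐓_k(s)` of record, `TkOfRecord`).  This file types THE STATEMENT «the density has the form (2.18), (2.23) with terms satisfying the inductive assumptions
(2.24)–(2.42)» — Theorem 1 [III] p. 262's CONTENT — as a PREDICATE ON SLOT FAMILIES of record, i.e. on the sequence-indexed densities `s ↦ slot_k(s)` whose
`χ`-weighted sum `Σ_s χ_k(s)·slot_k(s)` is the density of record (`Node00.densityOfRepr`, FILE 4; `densOfRecord₁₀`, `Record10`).  Nothing of Bałaban is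
asserted: the predicate is DEFINED; `Record11` (11d) keys the residual format slots `Residual₅.S218` ∕ `Stage9Params.ScorrLaw` on it.

THE DICTIONARY (print ↦ decl).
* «ρ_k = Σ χ_k 𝐓_k exp A_k» (2.18) with (2.23) ↦ per sequence `s`: `slot_k(s) = sect2Slot … s t E_k U_k` := `TkOfRecord … k s (sect2Operand … s t E_k U_k)`,
  the operand being `(a, 𝐖) ↦ exp (action23 (sect2ActionDataOfRecord … s t a E_k) k (U_k 𝐖))` — r11's `LFActionData.action23` = (2.23) with (2.25), (2.30),
  (2.40)–(2.41) substituted, read at the background `U_k = U_k(𝐖)` of the retained multi-scale configuration `𝐖` (the map `U_k : MSField → GaugeField _ 0 _`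
  of (2.12)–(2.16)∕(2.19) is a PARAMETER here — `BgMap`; the R-side definer names the map of record (`B14Eq213DetSet.minConf` ∕ `Node00.UminOfRecord` on the
  determining set of the sequence) and 11d binds it).
* «terms satisfying (i)–(iv) (2.27)–(2.29), (2.31), (2.41)–(2.42) for j = 1, …, k» ↦ `Sect2.LawsRT T c k := Step.LFHyp T c k ∧ B14.Eq227LocalizedTerms.LFHypAnalytic
  T c k` on the tower of record `T = sect2TowerOfRecord … s t` with the constants `c = S.lf`;  p. 262 ∕ p. 279 «after the operation 𝐓 we obtain 𝐓ρ_k represented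
  exactly in the form described by the inductive assumption with k+1 instead of k … the newly created expressions E^{(k+1)}, R^{(k+1)}, B^{(k+1)} … have better
  decay properties, with κ replaced by (1+4β)κ» ↦ `Sect2.LawsT T c β k := LFHyp T c k ∧ Step.LFNewTerms T c β k ∧ LFHypAnalytic T c (k+1)`.
* «E_k (depending on {Ω_j}, {Λ_j} also)» p. 262 ↦ the constant is sequence-indexed witness data `Ek s`;  «𝐄^{(j)}(X, U_k, z)» carries NO sequence argument in
  print ((2.25)–(2.27)) ↦ `Sect2.UniversalE t : ∀ s s', (t s).E = (t s').E`, while `𝐑^{(j)}(X, ·)`, `𝐁^{(j)}(X, ·, {S_i ∩ X})` ((2.30), (2.40): created along the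
  large-field history) may depend on `s`.
* THE PREDICATE: `HasSect2FormWith … n U law slot := ∃ t E_k, UniversalE t ∧ ∀ s, law s (t s) ∧ (∀ V, χ_n(s)(V) ≠ 0 → slot s V = sect2Slot … s (t s) (E_k s) (U s) V)`
  — the identity is demanded ON THE SUPPORT of `chiSeqOfRecord … s` only (off it the slot is not read by (2.18));  `HasSect2Form … k` := `law = LawsRT … k`
  (post-𝐑𝐓, index k: the inductive assumption proper);  `HasSect2FormT … k` := sequences of length `k+1`, `law = LawsT … k` (post-𝐓, before 𝐑: the
  «corresponding space» of the T-image, p. 262 ∕ Def. of p. 279).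
* p. 259 after (2.28): «the inductive assumptions (2.7) imply U_k ∈ U^c_j(X, α_{0,j}, α_{1,j}) … hence 𝐄^{(j)}(X, U_k, z) are well defined» ↦ the DISPLAYED
  PROVISO `BgProviso … k Supp U` (the background of record lies in the spaces of record `spaceI` ∕ `spaceMS` on a support set `Supp s` of retained
  configurations) — print-true by [14]∕[15] and (2.7), NOT asserted; `Record11` displays it.

NON-VACUITY (plan invariant I3 ∕ RIDER №33; def-R RFACE-NOTE-11b-bg-g4 §2(b)).  The spaces `U^c_j(X, α₀, α₁)` ∕ `Ũ^c_j(X, α̃₀, α̃₁)` of record read RESIDUAL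
background functions (`Sect2.Residual.bgI ∕ bgMS`, the (I.1.15)∕(2.35) maps, named not built); a junk residual could EMPTY them and make every bound of `LFHyp`
vacuous.  Cure, displayed: `Sect2.Residual.Laws` = «the unit configuration is sent to the unit ∕ zero configurations» (`U_n(M˙(1)) = 1`, `J_n(M˙(1)) = 0`,
`U_{p,X}(M˙(1)) = 1`, `𝐉_{p,X}(M˙(1)) = 0` — in print consequences of [15] Thm 1 and (1.8)), `Sect2.Setting.Pos` = the sign conditions `0 < O(1)LMB`,
`0 ≤ β < 1`, `0 < BCM`; under them and positive radii THE UNIT BACKGROUND LIES IN BOTH SPACES OF RECORD (`one_mem_spaceI`, `one_mem_spaceMS`, via r11's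
`unitPair_mem_space` ∕ `unitPair_mem_space234`), hence the bounds (2.27)(iv), (2.31), (2.42) BITE at least at the vacuum configuration `U = 1` that (2.23)
subtracts (`norm_E_one_le`, `norm_R_one_le`, `norm_B_one_le`), and under `BgProviso` at the background of record itself (`norm_E_bg_le`).  INHABITATION: the
law package holds for the ZERO term values exactly when the flow satisfies the RG equations (`lawsRT_towerOfTerms_zero`, hypotheses `Flow.SatisfiesRG`, signs),
so `HasSect2Form` is inhabited by the pure slot `𝐓_k(s) exp[−A(g_k^{−2}(·), U_k) − Σ_j β_j(g_{j−1}) A(φ_j, U_k) − E_k]` (`hasSect2Form_zeroTerms`) — the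
predicate is not contradictory, and not trivial (it fixes the slot on the χ-support).

FACES.  `LawsRT.zero` (k = 0: no terms, Theorem 1's start); `LawsT.toRT` (old terms), `LawsT.toRT_succ` (p. 262: the improved new-term bounds weaken to the
ordinary ones at k+1 under r11's sign conditions, `Step.LFHyp.succ`) and its lift `HasSect2FormT.toForm_succ`; monotonicity in the law `hasSect2FormWith_mono`;
`HasSect2FormWith.slot_nonneg` (on the χ-support a slot of §2 form is ≥ 0: `TkOfRecord_nonneg` on an exponential operand); `bgProviso_one`.

HONEST SCOPE.  Definitions of record + bookkeeping faces; 0 `sorry`; no `instance` ∕ `notation` ∕ attribute games; every decl cited.  NOT ASSERTED: Theorem 1,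
Theorem 2 [III], any bound, any analyticity, [14]∕[15].  NOT TYPED (located, successors): the Euclidean covariance (2.29)∕(2.32)–(2.33) (r11 `Step.LFCov` over
symmetry data `Step.LFSymm` — no symmetry datum of record in the tree; a successor conjoins `LFCov` when one is typed); the «slightly larger spaces» of the new
terms (r11 DIVERGENCE D-f2.7); the (2.43)-style bookkeeping of `E_k` (witness data here); the pin of `U_k` (parameter `U`, 11d).  One finite torus `F.P K`; not
continuum ∕ OS ∕ mass-gap ∕ Clay; counts unmoved (typed 28∕28 · discharged 5∕28).
-/

open MeasureTheory Set
open scoped BigOperators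

namespace Literature.MathematicalPhysics.QuantumFieldTheory.Balaban1983to89.Node00

open Literature.MathematicalPhysics.QuantumFieldTheory.Balaban1983to89
open Step T4Continuum B14.Eq218Concrete B14.Eq227LocalizedTerms

noncomputable section

namespace Sect2

/-! ## §1  The law packages over a tower (generic) -/

section Laws

variable {P : Params} {G : Type*} [GaugeGroup G] {Φ 𝒢 𝔄 : Type*} [NormedAddCommGroup Φ] [NormedSpace ℂ Φ]

/-- **THE INDUCTIVE ASSUMPTIONS AT INDEX `k` (post-𝐑𝐓)**: (i)–(iv) of (2.27)–(2.28), (2.31), (2.41)–(2.42) for `j = 1, …, k` with the RG equations of the flow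
(r11's `Step.LFHyp`) AND the word «analytic» ((2.27)(ii), (2.30), (2.41)(ii): r11's `LFHypAnalytic`). [cite: Balaban1988Convergent, (2.27)–(2.31) pp.259–260, (2.41)–(2.42) p.261] -/
def LawsRT (T : LFTower P G Φ 𝒢 𝔄) (c : LFConsts) (k : ℕ) : Prop :=
  LFHyp T c k ∧ LFHypAnalytic T c k

/-- **THE LAWS OF THE 𝐓-IMAGE** (p. 262, p. 279 «𝐓ρ_k represented exactly in the form described by the inductive assumption with k+1 instead of k», the new
terms `E^{(k+1)}, R^{(k+1)}, B^{(k+1)}` with the IMPROVED decay `(1+4β)κ`): old terms as at `k`, r11's `Step.LFNewTerms … k` for the new ones, analyticity through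
`k+1`. [cite: Balaban1988Convergent, §2 p.262, §3 p.279] -/
def LawsT (T : LFTower P G Φ 𝒢 𝔄) (c : LFConsts) (βc : ℝ) (k : ℕ) : Prop :=
  LFHyp T c k ∧ LFNewTerms T c βc k ∧ LFHypAnalytic T c (k + 1)

/-- At `k = 0` the inductive assumptions are vacuous (Theorem 1's start `ρ₀ = exp[−(1∕g₀²)A − E]` has no terms). [cite: Balaban1988Convergent, Thm 1 p.262] -/
theorem LawsRT.zero (T : LFTower P G Φ 𝒢 𝔄) (c : LFConsts) : LawsRT T c 0 :=
  ⟨LFHyp.zero T c, LFHypAnalytic.zero T c⟩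

/-- The laws of the 𝐓-image contain the laws at index `k` («the expressions with indices j ≤ k are exactly as described above»). [cite: Balaban1988Convergent, §2 p.262] -/
theorem LawsT.toRT {T : LFTower P G Φ 𝒢 𝔄} {c : LFConsts} {βc : ℝ} {k : ℕ} (h : LawsT T c βc k) : LawsRT T c k :=
  ⟨h.1, h.2.2.mono (Nat.le_succ k)⟩

/-- **p. 262 as bookkeeping**: the improved bounds of the new terms weaken to the ordinary ones, so the 𝐓-image laws at `k` give the inductive assumptions at
`k+1` under r11's sign conditions (`Step.LFHyp.succ`). [cite: Balaban1988Convergent, §2 p.262] -/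
theorem LawsT.toRT_succ {T : LFTower P G Φ 𝒢 𝔄} {c : LFConsts} {βc : ℝ} {k : ℕ} (h : LawsT T c βc k) (hβ : 0 ≤ βc) (hκ : 0 ≤ c.κ)
    (hE₀ : 0 ≤ c.E₀) (hB₀ : 0 ≤ c.B₀) (hg : 0 ≤ T.flow.g (k + 1)) : LawsRT T c (k + 1) :=
  ⟨h.1.succ h.2.1 hβ hκ hE₀ hB₀ hg, h.2.2⟩

end Laws

/-! ## §2  Displayed laws of the residual, sign conditions of the setting, NON-VACUITY of the spaces of record -/

section UnitPair

variable {P : Params} {𝔸 : Type*} [NormedRing 𝔸] {G : Type*} [GaugeGroup G]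

/-- The unit background field read in `Φ` is r11's unit pair `(1, 0)`. [cite: Balaban1987RG1, (1.15)–(1.16) p.262 (bookkeeping)] -/
theorem ofBackgroundC_one (ι : G →* 𝔸ˣ) :
    ofBackgroundC (P := P) ι (1 : GaugeField P 0 G) = embedPair (B12RegularSpaces111Mono.unitPair (P := P) (i := 0) (𝔸 := 𝔸)) := by
  refine Prod.ext (funext fun b => ?_) (funext fun _ => rfl)
  show ((ι ((1 : GaugeField P 0 G) b) : 𝔸ˣ) : 𝔸) = ((1 : 𝔸ˣ) : 𝔸)
  rw [show (1 : GaugeField P 0 G) b = 1 from rfl, map_one]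

end UnitPair

section NonVacuity

variable {P : Params} {𝔸 : Type*} [NormedRing 𝔸] [NormedAlgebra ℂ 𝔸] [CompleteSpace 𝔸]

/-- **THE DISPLAYED LAWS OF THE RESIDUAL BACKGROUND FUNCTIONS** (I.1.15) ∕ (2.35): the unit configuration is sent to the unit configuration and to the zero
current — `U_n(M˙(1)) = 1`, `J_n(M˙(1)) = 0`, `U_{p,X}(M˙(1)) = 1`, `𝐉_{p,X}(M˙(1)) = 0` (in print: the unit configuration is the minimiser of its own averages,
[15] Thm 1, and `J(1) = 0` by (1.8); here, where the maps are residual data, DISPLAYED so that the spaces of record are provably non-empty — exactly the hypotheses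
`hUn`∕`hJn`∕`hUp`∕`hJp` of r11's `unitPair_mem_space` ∕ `unitPair_mem_space234`). [cite: Balaban1987RG1, (1.15) p.262; Balaban1988Convergent, (2.35) p.261] -/
structure Residual.Laws (Rz : Residual P 𝔸) : Prop where
  /-- `U_n(M˙(1)) = 1` -/
  bgI_Un_one : ∀ j Y n, (Rz.bgI j Y).Un n 1 = 1
  /-- `J_n(M˙(1)) = 0` -/
  bgI_Jn_one : ∀ j Y n b, (Rz.bgI j Y).Jn n 1 b = 0
  /-- `U_{p,X}(M˙(1)) = 1` -/
  bgMS_Up_one : ∀ j Y p, (Rz.bgMS j Y).Up p 1 = 1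
  /-- `𝐉_{p,X}(M˙(1)) = 0` -/
  bgMS_Jp_one : ∀ j Y p b, (Rz.bgMS j Y).Jp p 1 b = 0

variable {G : Type*} [GaugeGroup G]

/-- **THE SIGN CONDITIONS OF THE SETTING** the spaces need to be non-empty: `0 < O(1)LMB` (I.1.12), `0 ≤ β < 1` and `0 < B·C·M` ((2.34)–(2.39); «e.g., we can take
β = 1∕4», p. 261). [cite: Balaban1987RG1, (1.12) p.262; Balaban1988Convergent, (2.34)–(2.39) p.261] -/
structure Setting.Pos (S : Setting 𝔸 G) : Prop where
  /-- `0 < O(1)LMB` -/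
  cB_pos : 0 < S.cB
  /-- `0 ≤ β` -/
  βc_nonneg : 0 ≤ S.βc
  /-- `β < 1` -/
  βc_lt_one : S.βc < 1
  /-- `0 < BCM` -/
  BCM_pos : 0 < S.B * S.C * S.Mr

/-- `L ≠ 0` as a real number. [cite: Balaban1987RG1, (0.1) p.251 (bookkeeping)] -/
theorem L_cast_ne_zero (P : Params) : (P.L : ℝ) ≠ 0 :=
  Nat.cast_ne_zero.mpr P.L_pos.ne'

/-- **NON-VACUITY OF `U^c_j(X, α₀, α₁)` OF RECORD**: under the residual laws, `0 < O(1)LMB` and positive radii, the unit background lies in the space (r11's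
`unitPair_mem_space` at the frame of record). [cite: Balaban1987RG1, (1.11)–(1.16) p.262] -/
theorem one_mem_spaceI (S : Setting 𝔸 G) (hc : 0 < S.cB) {Rz : Residual P 𝔸} (hRz : Rz.Laws) (M j : ℕ) (Y : Set (Site P 0)) {α₀ α₁ : ℝ}
    (h₀ : 0 < α₀) (h₁ : 0 < α₁) : ofBackgroundC S.ι (1 : GaugeField P 0 G) ∈ spaceI S Rz M j Y α₀ α₁ := by
  rw [ofBackgroundC_one]
  exact ⟨_, B12RegularSpaces111Mono.unitPair_mem_space (frameI Rz M j Y)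
    (pow_pos (inv_pos.mpr (Nat.cast_pos.mpr P.L_pos)) j).ne' (L_cast_ne_zero P) hc h₀ h₁ h₀
    (hRz.bgI_Un_one j Y) (hRz.bgI_Jn_one j Y), rfl⟩

/-- **NON-VACUITY OF `Ũ^c_j(X, α̃₀, α̃₁)` OF RECORD**: under the residual laws, the sign conditions and positive radii along the flow, the unit background lies in
the space (r11's `unitPair_mem_space234` at the frame of record). [cite: Balaban1988Convergent, (2.34)–(2.39) p.261] -/
theorem one_mem_spaceMS (S : Setting 𝔸 G) (hS : S.Pos) {Rz : Residual P 𝔸} (hRz : Rz.Laws) (M j : ℕ) (Y : Set (Site P 0)) (Ω : ℕ → Set (Site P 0))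
    (hα₀ : ∀ n, 0 < S.lf.alpha0 (S.flow.g n)) (hα₁ : ∀ n, 0 < S.lf.alpha1 (S.flow.g n)) :
    ofBackgroundC S.ι (1 : GaugeField P 0 G) ∈ spaceMS S Rz M j Y Ω := by
  rw [ofBackgroundC_one]
  exact ⟨_, B14RegularSpaces234Inner.unitPair_mem_space234 (frameMS Rz M j Y Ω) hS.βc_nonneg hS.βc_lt_one (Nat.cast_pos.mpr P.L_pos)
    (pow_pos (inv_pos.mpr (Nat.cast_pos.mpr P.L_pos)) j)
    hS.BCM_pos hα₀ hα₁ (hRz.bgMS_Up_one j Y) (hRz.bgMS_Jp_one j Y), rfl⟩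

variable {V : Type*} {M : ℕ}

/-- The space field of the tower of record, by `rfl`. [cite: Balaban1988Convergent, (2.27)(ii) p.259 (bookkeeping)] -/
theorem towerOfTerms_space (S : Setting 𝔸 G) (Rz : Residual P 𝔸) (M : ℕ) (Ω : ℕ → Set (Site P 0)) (t : TermValues P 𝔸 V M) (j : ℕ)
    (X : ((towerOfTerms S Rz M Ω t).sys j).Dom) (α₀ α₁ : ℝ) :
    (towerOfTerms S Rz M Ω t).space j X α₀ α₁ = spaceI S Rz M j (domSites P M j X) α₀ α₁ := rfl

/-- The boundary-term space field of the tower of record, by `rfl`. [cite: Balaban1988Convergent, (2.41)(ii) p.261 (bookkeeping)] -/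
theorem towerOfTerms_spaceB (S : Setting 𝔸 G) (Rz : Residual P 𝔸) (M : ℕ) (Ω : ℕ → Set (Site P 0)) (t : TermValues P 𝔸 V M) (j : ℕ)
    (X : ((towerOfTerms S Rz M Ω t).sys j).Dom) : (towerOfTerms S Rz M Ω t).spaceB j X = spaceMS S Rz M j (domSites P M j X) Ω := rfl

/-- The vacuum background `U = 1` (the configuration (2.23) subtracts at) lies in the tower's space `U^c_j(X, α₀, α₁)`. [cite: Balaban1988Convergent, (2.23) p.258, (2.27)(ii) p.259] -/
theorem ofBackground_one_mem_space (S : Setting 𝔸 G) (hc : 0 < S.cB) {Rz : Residual P 𝔸} (hRz : Rz.Laws) (M : ℕ) (Ω : ℕ → Set (Site P 0))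
    (t : TermValues P 𝔸 V M) (j : ℕ) (X : ((towerOfTerms S Rz M Ω t).sys j).Dom) {α₀ α₁ : ℝ} (h₀ : 0 < α₀) (h₁ : 0 < α₁) :
    (towerOfTerms S Rz M Ω t).ofBackground 1 ∈ (towerOfTerms S Rz M Ω t).space j X α₀ α₁ :=
  one_mem_spaceI S hc hRz M j _ h₀ h₁

/-- The vacuum background lies in the tower's boundary-term space `Ũ^c_j(X, α̃₀, α̃₁)`. [cite: Balaban1988Convergent, (2.41)(ii) p.261] -/
theorem ofBackground_one_mem_spaceB (S : Setting 𝔸 G) (hS : S.Pos) {Rz : Residual P 𝔸} (hRz : Rz.Laws) (M : ℕ) (Ω : ℕ → Set (Site P 0))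
    (t : TermValues P 𝔸 V M) (j : ℕ) (X : ((towerOfTerms S Rz M Ω t).sys j).Dom) (hα₀ : ∀ n, 0 < S.lf.alpha0 (S.flow.g n))
    (hα₁ : ∀ n, 0 < S.lf.alpha1 (S.flow.g n)) : (towerOfTerms S Rz M Ω t).ofBackground 1 ∈ (towerOfTerms S Rz M Ω t).spaceB j X :=
  one_mem_spaceMS S hS hRz M j _ Ω hα₀ hα₁

/-- **THE BOUND (2.27)(iv) BITES AT THE VACUUM**: under the laws at index `k`, the subtracted values `𝐄^{(j)}(X, 1, z)` of (2.23) obey `|𝐄^{(j)}(X, 1, z)| ≤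
E₀ exp(−κ d_j(X))` — the law package is not vacuous at the frame of record. [cite: Balaban1988Convergent, (2.23) p.258, (2.27)(iv) p.259] -/
theorem norm_E_one_le {S : Setting 𝔸 G} (hc : 0 < S.cB) {Rz : Residual P 𝔸} (hRz : Rz.Laws) {M : ℕ} {Ω : ℕ → Set (Site P 0)} {t : TermValues P 𝔸 V M}
    {k : ℕ} (h : LFHyp (towerOfTerms S Rz M Ω t) S.lf k) (hα₀ : ∀ n, 0 < S.lf.alpha0 (S.flow.g n)) (hα₁ : ∀ n, 0 < S.lf.alpha1 (S.flow.g n))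
    {j : ℕ} (h1 : 1 ≤ j) (hj : j ≤ k) (X : (domSys P M j).Dom) (z : Site P j) {g : ℝ} (hg0 : 0 ≤ g) (hgγ : g ≤ S.lf.γ) :
    ‖t.E j X z g (ofBackgroundC S.ι 1)‖ ≤ S.lf.E₀ * Real.exp (-S.lf.κ * (domSys P M j).dj X) :=
  h.boundE j h1 hj X z g _ hg0 hgγ (one_mem_spaceI S hc hRz M j _ (hα₀ j) (hα₁ j))

/-- **THE BOUND (2.31) BITES AT THE VACUUM**: `|𝐑^{(j)}(X, 1)| ≤ g_j^{κ₀} exp(−κ d_j(X))`. [cite: Balaban1988Convergent, (2.30)–(2.31) p.260] -/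
theorem norm_R_one_le {S : Setting 𝔸 G} (hc : 0 < S.cB) {Rz : Residual P 𝔸} (hRz : Rz.Laws) {M : ℕ} {Ω : ℕ → Set (Site P 0)} {t : TermValues P 𝔸 V M}
    {k : ℕ} (h : LFHyp (towerOfTerms S Rz M Ω t) S.lf k) (hα₀ : ∀ n, 0 < S.lf.alpha0 (S.flow.g n)) (hα₁ : ∀ n, 0 < S.lf.alpha1 (S.flow.g n))
    {j : ℕ} (h1 : 1 ≤ j) (hj : j ≤ k) (X : (domSys P M j).Dom) :
    ‖t.R j X (ofBackgroundC S.ι 1)‖ ≤ S.flow.g j ^ S.lf.κ₀ * Real.exp (-S.lf.κ * (domSys P M j).dj X) :=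
  h.boundR j h1 hj X _ (one_mem_spaceI S hc hRz M j _ (hα₀ j) (hα₁ j))

/-- **THE BOUND (2.42) BITES AT THE VACUUM**: `|𝐁^{(j)}(X, 1, a)| ≤ B₀ exp(−κ d_j(X))`. [cite: Balaban1988Convergent, (2.41)–(2.42) p.261] -/
theorem norm_B_one_le {S : Setting 𝔸 G} (hS : S.Pos) {Rz : Residual P 𝔸} (hRz : Rz.Laws) {M : ℕ} {Ω : ℕ → Set (Site P 0)} {t : TermValues P 𝔸 V M}
    {k : ℕ} (h : LFHyp (towerOfTerms S Rz M Ω t) S.lf k) (hα₀ : ∀ n, 0 < S.lf.alpha0 (S.flow.g n)) (hα₁ : ∀ n, 0 < S.lf.alpha1 (S.flow.g n))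
    {j : ℕ} (h1 : 1 ≤ j) (hj : j ≤ k) (X : (domSys P M j).Dom) (a : Tk.SFluct P V) :
    ‖t.B j X (ofBackgroundC S.ι 1) a‖ ≤ S.lf.B₀ * Real.exp (-S.lf.κ * (domSys P M j).dj X) :=
  h.boundB j h1 hj X _ a (one_mem_spaceMS S hS hRz M j _ Ω hα₀ hα₁)

/-- **INHABITATION OF THE LAW PACKAGE**: the ZERO term values satisfy the inductive assumptions at every index `k` up to which the flow satisfies the RG equations
(0.20) [I] and stays nonnegative, for nonnegative `E₀, B₀` — the laws constrain the terms, they do not smuggle a contradiction. [cite: Balaban1988Convergent, (2.27)–(2.31) pp.259–260, (2.42) p.261; Balaban1987RG1, (0.20) p.256] -/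
theorem lawsRT_towerOfTerms_zero (S : Setting 𝔸 G) (Rz : Residual P 𝔸) (M : ℕ) (Ω : ℕ → Set (Site P 0)) (k : ℕ) (hrg : S.flow.SatisfiesRG k)
    (hE₀ : 0 ≤ S.lf.E₀) (hB₀ : 0 ≤ S.lf.B₀) (hg : ∀ j, j ≤ k → 0 ≤ S.flow.g j) :
    LawsRT (towerOfTerms S Rz M Ω (TermValues.zero (V := V))) S.lf k := by
  refine ⟨⟨fun j hj => hrg j hj, fun _ _ _ _ _ _ _ _ _ => rfl, fun _ _ _ _ _ _ _ => rfl, fun j _ _ X z g φ _ _ _ => ?_, fun j _ hj X φ _ => ?_,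
    fun j _ _ X φ a _ => ?_, fun _ _ _ _ _ _ _ _ => rfl, fun _ _ _ _ _ _ => rfl⟩, ⟨fun j _ _ X z g _ _ => ?_, fun j _ _ X => ?_, fun j _ _ X a => ?_⟩⟩
  · show ‖(0 : ℂ)‖ ≤ _
    rw [norm_zero]
    exact mul_nonneg hE₀ (Real.exp_nonneg _)
  · show ‖(0 : ℂ)‖ ≤ _
    rw [norm_zero]
    exact mul_nonneg (pow_nonneg (hg j hj) _) (Real.exp_nonneg _)
  · show ‖(0 : ℂ)‖ ≤ _
    rw [norm_zero]
    exact mul_nonneg hB₀ (Real.exp_nonneg _)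
  · exact analyticOnNhd_const
  · exact analyticOnNhd_const
  · exact analyticOnNhd_const

end NonVacuity

section Universal

variable {P : Params} {𝔸 : Type*} {V : Type*} {M : ℕ}

/-- Every term-value family with one member is universal in its 𝐄-component; in general **UNIVERSALITY OF THE 𝐄-TERMS** across an index: `𝐄^{(j)}(X, ·, z)`
carries no sequence argument in print. [cite: Balaban1988Convergent, (2.25)–(2.27) p.259] -/
def UniversalE {ι : Type*} (t : ι → TermValues P 𝔸 V M) : Prop :=
  ∀ i i', (t i).E = (t i').E

/-- A constant family is universal. [cite: Balaban1988Convergent, (2.25)–(2.27) p.259 (bookkeeping)] -/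
theorem universalE_const {ι : Type*} (t₀ : TermValues P 𝔸 V M) : UniversalE (fun _ : ι => t₀) :=
  fun _ _ => rfl

end Universal

end Sect2

/-! ## §3  OF RECORD: the §2-form slot, the predicate, its two instances, the background proviso -/

section OfRecordFrame

variable (F : T4Family) (N : ℕ) [NeZero N] (V : Type) {𝔸 : Type*} [NormedRing 𝔸] [NormedAlgebra ℂ 𝔸] [CompleteSpace 𝔸]

/-- The type of the BACKGROUND MAP `𝐖 ↦ U_k(𝐖)` of (2.19)∕(2.23) on the torus `F.P K`: the (2.12)–(2.16) minimal configuration of the retained multi-scale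
configuration (a PARAMETER of this file; the R-side definer's `B14Eq213DetSet.minConf` ∕ `Node00.UminOfRecord` on the determining set of the sequence is the map of
record, bound at 11d). [cite: Balaban1988Convergent, (2.12)–(2.16) pp.256–257, (2.19) p.258] -/
abbrev BgMap (K : ℕ) : Type :=
  B15DeterminingSets.MSField (F.P K) (SU N) → GaugeField (F.P K) 0 (SU N)

/-- **THE OPERAND `exp A_k` OF (2.18)** along the sequence `s` with term values `t`, constant `E_k` and background map `U_k`: `(a, 𝐖) ↦ exp A_k(𝐖)`, `A_k` = r11's
`action23` of the action data of record (11b) read at `U_k(𝐖)` — in r11's operand shape `SFluct → MSField → ℝ` of `TkOfRecord`.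
[cite: Balaban1988Convergent, (2.18) p.257, (2.23) p.258] -/
def sect2Operand (K : ℕ) (S : Sect2.Setting 𝔸 (SU N)) (Rz : Sect2.Residual (F.P K) 𝔸) {ν : Stage7Numerics} {M : ℕ} {g : ℕ → ℝ} {k : ℕ}
    (s : SeqOfRecord F ν M g K k) (t : Sect2.TermValues (F.P K) 𝔸 V M) (Ek : ℝ) (U : BgMap F N K) :
    Tk.SFluct (F.P K) V → B15DeterminingSets.MSField (F.P K) (SU N) → ℝ :=
  fun a W => Real.exp ((sect2ActionDataOfRecord F N V K S Rz s t a Ek).action23 k (U W))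

variable {F N V} in
/-- The operand is positive (an exponential). [cite: Balaban1988Convergent, (2.18) p.257 (bookkeeping)] -/
theorem sect2Operand_pos (K : ℕ) (S : Sect2.Setting 𝔸 (SU N)) (Rz : Sect2.Residual (F.P K) 𝔸) {ν : Stage7Numerics} {M : ℕ} {g : ℕ → ℝ} {k : ℕ}
    (s : SeqOfRecord F ν M g K k) (t : Sect2.TermValues (F.P K) 𝔸 V M) (Ek : ℝ) (U : BgMap F N K) (a : Tk.SFluct (F.P K) V)
    (W : B15DeterminingSets.MSField (F.P K) (SU N)) : 0 < sect2Operand F N V K S Rz s t Ek U a W :=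
  Real.exp_pos _

/-- **THE DISPLAYED BACKGROUND PROVISO** (p. 259 after (2.28): «the inductive assumptions (2.7) imply U_k ∈ U^c_j(X, α_{0,j}, α_{1,j}) for proper restrictions
on ε_j, hence 𝐄^{(j)}(X, U_k, z) are well defined»; likewise `Ũ^c_j(X)` for the boundary terms): on a support set `Supp s` of retained configurations (in print:
where `χ_k(s)` and the `χ(Y, S)` of (2.21) do not vanish), the background of record read in `Φ` lies in both spaces of record at every scale `1 ≤ j ≤ k` and every
`X ∈ 𝐃_j`.  Print-true by [14], [15] and (2.7); DISPLAYED, never asserted; `Record11` carries it as a proviso. [cite: Balaban1988Convergent, (2.28) p.259, (2.7) p.255] -/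
def BgProviso (K : ℕ) (S : Sect2.Setting 𝔸 (SU N)) (Rz : Sect2.Residual (F.P K) 𝔸) {ν : Stage7Numerics} (M : ℕ) {g : ℕ → ℝ} {n : ℕ} (k : ℕ)
    (Supp : SeqOfRecord F ν M g K n → Set (B15DeterminingSets.MSField (F.P K) (SU N))) (U : SeqOfRecord F ν M g K n → BgMap F N K) : Prop :=
  ∀ s W, W ∈ Supp s → ∀ j, 1 ≤ j → j ≤ k → ∀ X : (Sect2.domSys (F.P K) M j).Dom,
    Sect2.ofBackgroundC S.ι (U s W) ∈
        Sect2.spaceI S Rz M j (Sect2.domSites (F.P K) M j X) (S.lf.alpha0 (S.flow.g j)) (S.lf.alpha1 (S.flow.g j)) ∧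
      Sect2.ofBackgroundC S.ι (U s W) ∈ Sect2.spaceMS S Rz M j (Sect2.domSites (F.P K) M j X) s.Ω

variable {F N} in
/-- **NON-VACUITY OF THE PROVISO**: the constant unit background map satisfies it (under the residual laws, the sign conditions and positive radii along the
flow) — `one_mem_spaceI` ∕ `one_mem_spaceMS`. [cite: Balaban1988Convergent, (2.28) p.259; Balaban1987RG1, (1.15)–(1.16) p.262] -/
theorem bgProviso_one (K : ℕ) {S : Sect2.Setting 𝔸 (SU N)} (hS : S.Pos) {Rz : Sect2.Residual (F.P K) 𝔸} (hRz : Rz.Laws) {ν : Stage7Numerics} (M : ℕ)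
    {g : ℕ → ℝ} {n : ℕ} (k : ℕ) (Supp : SeqOfRecord F ν M g K n → Set (B15DeterminingSets.MSField (F.P K) (SU N)))
    (hα₀ : ∀ m, 0 < S.lf.alpha0 (S.flow.g m)) (hα₁ : ∀ m, 0 < S.lf.alpha1 (S.flow.g m)) :
    BgProviso F N K S Rz M k Supp (fun _ _ => 1) :=
  fun s _ _ j _ _ _ => ⟨Sect2.one_mem_spaceI S hS.cB_pos hRz M j _ (hα₀ j) (hα₁ j), Sect2.one_mem_spaceMS S hS hRz M j _ s.Ω hα₀ hα₁⟩

end OfRecordFrame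

section OfRecord

open Tk

variable (F : T4Family) (N : ℕ) [NeZero N] (V : Type) [NormedAddCommGroup V] [InnerProductSpace ℝ V] [FiniteDimensional ℝ V]
  [MeasurableSpace V] [BorelSpace V] {𝔸 : Type*} [NormedRing 𝔸] [NormedAlgebra ℂ 𝔸] [CompleteSpace 𝔸]

/-- **THE §2-FORM SLOT `𝐓_k(s) exp A_k(s)`** — one summand of (2.18) before the `χ_k(s)`-weight, GIVEN term values: 11a's `TkOfRecord` applied to the operand.
[cite: Balaban1988Convergent, (2.18) p.257, (2.23) p.258] -/
def sect2Slot (K : ℕ) (S : Sect2.Setting 𝔸 (SU N)) (Rz : Sect2.Residual (F.P K) 𝔸) (W : TkWeights F N V K) {ν : Stage7Numerics} {M : ℕ} {g : ℕ → ℝ}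
    {k : ℕ} (s : SeqOfRecord F ν M g K k) (t : Sect2.TermValues (F.P K) 𝔸 V M) (Ek : ℝ) (U : BgMap F N K) : Density (F.P K) k (SU N) :=
  TkOfRecord F N V ν M g K W k s (sect2Operand F N V K S Rz s t Ek U)

variable {F N V} in
/-- A §2-form slot is nonnegative under the weight laws (11a's `TkOfRecord_nonneg` on a positive operand). [cite: Balaban1988Convergent, (2.18) p.257, (2.21) p.258] -/
theorem sect2Slot_nonneg (K : ℕ) (S : Sect2.Setting 𝔸 (SU N)) (Rz : Sect2.Residual (F.P K) 𝔸) {W : TkWeights F N V K} (hW : W.Laws) {ν : Stage7Numerics}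
    {M : ℕ} {g : ℕ → ℝ} {k : ℕ} (s : SeqOfRecord F ν M g K k) (t : Sect2.TermValues (F.P K) 𝔸 V M) (Ek : ℝ) (U : BgMap F N K)
    (Vk : GaugeField (F.P K) k (SU N)) : 0 ≤ sect2Slot F N V K S Rz W s t Ek U Vk :=
  TkOfRecord_nonneg F N V ν M g K hW k s (fun a U' => (sect2Operand_pos K S Rz s t Ek U a U').le) Vk

/-- **THE §2 FORM OF A SLOT FAMILY, WITH A LAW PACKAGE** at sequence length `n`: there are term values `t s` (universal in the 𝐄-component) and constants `E_k(s)`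
such that every `t s` obeys `law s`, and ON THE SUPPORT OF `χ_n(s)` the slot IS `𝐓_n(s) exp A_n(s)`. [cite: Balaban1988Convergent, (2.18) p.257, (2.23)–(2.42) pp.258–261, Thm 1 p.262] -/
def HasSect2FormWith (K : ℕ) (S : Sect2.Setting 𝔸 (SU N)) (Rz : Sect2.Residual (F.P K) 𝔸) (W : TkWeights F N V K) {ν : Stage7Numerics} {M : ℕ}
    {g : ℕ → ℝ} (n : ℕ) (U : SeqOfRecord F ν M g K n → BgMap F N K)
    (law : SeqOfRecord F ν M g K n → Sect2.TermValues (F.P K) 𝔸 V M → Prop) (slot : SeqOfRecord F ν M g K n → Density (F.P K) n (SU N)) : Prop :=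
  ∃ (t : SeqOfRecord F ν M g K n → Sect2.TermValues (F.P K) 𝔸 V M) (Ek : SeqOfRecord F ν M g K n → ℝ),
    Sect2.UniversalE t ∧ ∀ s, law s (t s) ∧
      ∀ Vn, chiSeqOfRecord F N ν M g K n s Vn ≠ 0 → slot s Vn = sect2Slot F N V K S Rz W s (t s) (Ek s) (U s) Vn

/-- **THE §2 FORM AT INDEX `k` (post-𝐑𝐓)** — Theorem 1 [III]'s content for the slot family of a density `ρ_k`: `HasSect2FormWith` with the inductive assumptions
`Sect2.LawsRT … k` on the tower of record along each sequence. [cite: Balaban1988Convergent, Thm 1 p.262, (2.18) p.257, (2.23) p.258] -/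
def HasSect2Form (K : ℕ) (S : Sect2.Setting 𝔸 (SU N)) (Rz : Sect2.Residual (F.P K) 𝔸) (W : TkWeights F N V K) {ν : Stage7Numerics} {M : ℕ}
    {g : ℕ → ℝ} (k : ℕ) (U : SeqOfRecord F ν M g K k → BgMap F N K) (slot : SeqOfRecord F ν M g K k → Density (F.P K) k (SU N)) : Prop :=
  HasSect2FormWith F N V K S Rz W k U (fun s t => Sect2.LawsRT (sect2TowerOfRecord F N V K S Rz s t) S.lf k) slot

/-- **THE §2 FORM OF THE 𝐓-IMAGE** (p. 262, p. 279: the «corresponding space» of `𝐓ρ_k` — sequences of length `k+1`, old terms as at `k`, new terms with the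
improved bounds, before the 𝐑-operation): `HasSect2FormWith` at length `k+1` with `Sect2.LawsT … k`. [cite: Balaban1988Convergent, §2 p.262, §3 p.279] -/
def HasSect2FormT (K : ℕ) (S : Sect2.Setting 𝔸 (SU N)) (Rz : Sect2.Residual (F.P K) 𝔸) (W : TkWeights F N V K) {ν : Stage7Numerics} {M : ℕ}
    {g : ℕ → ℝ} (k : ℕ) (U : SeqOfRecord F ν M g K (k + 1) → BgMap F N K)
    (slotT : SeqOfRecord F ν M g K (k + 1) → Density (F.P K) (k + 1) (SU N)) : Prop :=
  HasSect2FormWith F N V K S Rz W (k + 1) U (fun s t => Sect2.LawsT (sect2TowerOfRecord F N V K S Rz s t) S.lf S.βc k) slotT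

variable {F N V}

/-- The predicate is monotone in the law package. [cite: Balaban1988Convergent, Thm 1 p.262 (bookkeeping)] -/
theorem hasSect2FormWith_mono {K : ℕ} {S : Sect2.Setting 𝔸 (SU N)} {Rz : Sect2.Residual (F.P K) 𝔸} {W : TkWeights F N V K} {ν : Stage7Numerics}
    {M : ℕ} {g : ℕ → ℝ} {n : ℕ} {U : SeqOfRecord F ν M g K n → BgMap F N K}
    {law law' : SeqOfRecord F ν M g K n → Sect2.TermValues (F.P K) 𝔸 V M → Prop} (hl : ∀ s t, law s t → law' s t)
    {slot : SeqOfRecord F ν M g K n → Density (F.P K) n (SU N)} (h : HasSect2FormWith F N V K S Rz W n U law slot) :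
    HasSect2FormWith F N V K S Rz W n U law' slot := by
  obtain ⟨t, Ek, hu, hs⟩ := h
  exact ⟨t, Ek, hu, fun s => ⟨hl s _ (hs s).1, (hs s).2⟩⟩

/-- The 𝐓-image form contains the form with the OLD laws at index `k` (the terms of indices `≤ k` are «exactly as described above», p. 262). [cite: Balaban1988Convergent, §2 p.262] -/
theorem HasSect2FormT.toWith_lawsRT {K : ℕ} {S : Sect2.Setting 𝔸 (SU N)} {Rz : Sect2.Residual (F.P K) 𝔸} {W : TkWeights F N V K} {ν : Stage7Numerics}
    {M : ℕ} {g : ℕ → ℝ} {k : ℕ} {U : SeqOfRecord F ν M g K (k + 1) → BgMap F N K}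
    {slotT : SeqOfRecord F ν M g K (k + 1) → Density (F.P K) (k + 1) (SU N)} (h : HasSect2FormT F N V K S Rz W k U slotT) :
    HasSect2FormWith F N V K S Rz W (k + 1) U (fun s t => Sect2.LawsRT (sect2TowerOfRecord F N V K S Rz s t) S.lf k) slotT :=
  hasSect2FormWith_mono (fun _ _ hl => hl.toRT) h

/-- **p. 262 ∕ p. 279 as bookkeeping on the predicate**: a 𝐓-image family of §2 form satisfies the inductive assumptions at index `k+1` (the improved new-term
bounds weakened to the ordinary ones) under r11's sign conditions — the FORMAT half of «𝐑𝐓 transforms the space with the index k into the space with the index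
k+1»; what 𝐑 changes is the terms, not this statement. [cite: Balaban1988Convergent, §2 p.262, §3 p.279] -/
theorem HasSect2FormT.toForm_succ {K : ℕ} {S : Sect2.Setting 𝔸 (SU N)} {Rz : Sect2.Residual (F.P K) 𝔸} {W : TkWeights F N V K} {ν : Stage7Numerics}
    {M : ℕ} {g : ℕ → ℝ} {k : ℕ} {U : SeqOfRecord F ν M g K (k + 1) → BgMap F N K}
    {slotT : SeqOfRecord F ν M g K (k + 1) → Density (F.P K) (k + 1) (SU N)} (h : HasSect2FormT F N V K S Rz W k U slotT) (hβ : 0 ≤ S.βc)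
    (hκ : 0 ≤ S.lf.κ) (hE₀ : 0 ≤ S.lf.E₀) (hB₀ : 0 ≤ S.lf.B₀) (hg : 0 ≤ S.flow.g (k + 1)) :
    HasSect2Form F N V K S Rz W (k + 1) U slotT :=
  hasSect2FormWith_mono (fun _ _ hl => hl.toRT_succ hβ hκ hE₀ hB₀ hg) h

/-- **ON THE χ-SUPPORT A SLOT OF §2 FORM IS NONNEGATIVE** (under the weight laws): the identity conjunct read through `sect2Slot_nonneg` — the shape of FILE 10's
`0 ≤ slot` proviso. [cite: Balaban1988Convergent, (2.18) p.257, (2.21) p.258] -/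
theorem HasSect2FormWith.slot_nonneg {K : ℕ} {S : Sect2.Setting 𝔸 (SU N)} {Rz : Sect2.Residual (F.P K) 𝔸} {W : TkWeights F N V K} (hW : W.Laws)
    {ν : Stage7Numerics} {M : ℕ} {g : ℕ → ℝ} {n : ℕ} {U : SeqOfRecord F ν M g K n → BgMap F N K}
    {law : SeqOfRecord F ν M g K n → Sect2.TermValues (F.P K) 𝔸 V M → Prop} {slot : SeqOfRecord F ν M g K n → Density (F.P K) n (SU N)}
    (h : HasSect2FormWith F N V K S Rz W n U law slot) (s : SeqOfRecord F ν M g K n) (Vn : GaugeField (F.P K) n (SU N))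
    (hχ : chiSeqOfRecord F N ν M g K n s Vn ≠ 0) : 0 ≤ slot s Vn := by
  obtain ⟨t, Ek, -, hs⟩ := h
  rw [(hs s).2 Vn hχ]
  exact sect2Slot_nonneg K S Rz hW s (t s) (Ek s) (U s) Vn

/-- **INHABITATION OF THE PREDICATE**: the family of PURE slots `𝐓_k(s) exp[−A(g_k^{−2}(·), U_k) − Σ_j β_j(g_{j−1}) A(φ_j, U_k) − E_k(s)]` (zero term values) has
the §2 form at index `k` whenever the flow satisfies the RG equations up to `k`, stays nonnegative, and `E₀, B₀ ≥ 0` — the predicate is consistent, and it PINS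
the slot on the χ-support (not trivial). [cite: Balaban1988Convergent, Thm 1 p.262, (2.23) p.258; Balaban1987RG1, (0.20) p.256] -/
theorem hasSect2Form_zeroTerms (K : ℕ) (S : Sect2.Setting 𝔸 (SU N)) (Rz : Sect2.Residual (F.P K) 𝔸) (W : TkWeights F N V K) {ν : Stage7Numerics} {M : ℕ}
    {g : ℕ → ℝ} (k : ℕ) (U : SeqOfRecord F ν M g K k → BgMap F N K) (Ek : SeqOfRecord F ν M g K k → ℝ) (hrg : S.flow.SatisfiesRG k)
    (hE₀ : 0 ≤ S.lf.E₀) (hB₀ : 0 ≤ S.lf.B₀) (hg : ∀ j, j ≤ k → 0 ≤ S.flow.g j) :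
    HasSect2Form F N V K S Rz W k U (fun s => sect2Slot F N V K S Rz W s Sect2.TermValues.zero (Ek s) (U s)) :=
  ⟨fun _ => Sect2.TermValues.zero, Ek, Sect2.universalE_const _, fun s =>
    ⟨Sect2.lawsRT_towerOfTerms_zero (V := V) S Rz M s.Ω k hrg hE₀ hB₀ hg, fun _ _ => rfl⟩⟩

/-- **THE BOUND (2.27)(iv) BITES AT THE BACKGROUND OF RECORD**: under the §2 form at index `k` and the background proviso, for every sequence `s`, retained
configuration `𝐖 ∈ Supp s`, scale `1 ≤ j ≤ k`, domain `X`, point `z` and coupling `g ∈ [0, γ]`, the witnessing 𝐄-terms obey `|𝐄^{(j)}(X, U_k(𝐖), z)| ≤ E₀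
exp(−κ d_j(X))` — the estimate (2.23) actually reads. [cite: Balaban1988Convergent, (2.23) p.258, (2.27)(iv)–(2.28) p.259] -/
theorem HasSect2Form.norm_E_bg_le {K : ℕ} {S : Sect2.Setting 𝔸 (SU N)} {Rz : Sect2.Residual (F.P K) 𝔸} {W : TkWeights F N V K} {ν : Stage7Numerics}
    {M : ℕ} {g : ℕ → ℝ} {k : ℕ} {U : SeqOfRecord F ν M g K k → BgMap F N K} {slot : SeqOfRecord F ν M g K k → Density (F.P K) k (SU N)}
    (h : HasSect2Form F N V K S Rz W k U slot) {Supp : SeqOfRecord F ν M g K k → Set (B15DeterminingSets.MSField (F.P K) (SU N))}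
    (hU : BgProviso F N K S Rz M k Supp U) :
    ∃ t : SeqOfRecord F ν M g K k → Sect2.TermValues (F.P K) 𝔸 V M, Sect2.UniversalE t ∧
      ∀ s Wc, Wc ∈ Supp s → ∀ j, 1 ≤ j → j ≤ k → ∀ (X : (Sect2.domSys (F.P K) M j).Dom) (z : Site (F.P K) j) (g' : ℝ), 0 ≤ g' → g' ≤ S.lf.γ →
        ‖(t s).E j X z g' (Sect2.ofBackgroundC S.ι (U s Wc))‖ ≤ S.lf.E₀ * Real.exp (-S.lf.κ * (Sect2.domSys (F.P K) M j).dj X) := by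
  obtain ⟨t, Ek, hu, hs⟩ := h
  refine ⟨t, hu, fun s Wc hW j h1 hj X z g' hg0 hgγ => ?_⟩
  exact (hs s).1.1.boundE j h1 hj X z g' _ hg0 hgγ (hU s Wc hW j h1 hj X).1

end OfRecord

end

end Literature.MathematicalPhysics.QuantumFieldTheory.Balaban1983to89.Node00
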